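import Mathlib
import HarnessLib
import Summits.AtomisticToContinuum.Crystallization.Theorems.FrustratedLawDichotomyAperiodicFrustratedLawGapErgodicAverageLp

/-!
# Ergodic reduction for the crux `AperiodicFrustratedLawGap` — mean ergodic theorem for re-rooting averages

Route `FrustratedLawDichotomy`, crux `AperiodicFrustratedLawGap` (item `stmt-AtomisticToContinuum-27623`),
registered stub `stub_ergodicReduction` (skeleton `dd3251ad731e`); twelfth brick of step D5 (`hErg`; evidence
`D5-PLAN.md`): **step S1 complete**.  For every probability law `ν` on rooted `δ`-hard-core configurations with
Campbell measure invariant under re-rooting, every admissible weight `w` (measurable, even, positive, mass `≤ 1`)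
and every bounded measurable `f`, the CESÀRO AVERAGES of the POINTWISE re-rooting operator
`A f (S) = ∫ f((Θ(S,y)).1) dK(S)(y)` — measure-independent functions defined at every configuration — converge
in `L²(ν)` to an EXACTLY re-rooting-invariant measurable function `f̄` with `∫_I f̄ dν = ∫_I f dν` for every
measurable invariant `I` (i.e. `f̄` is a version of `E_ν[f | 𝓘]`).  Proof: von Neumann's mean ergodic theorem
(Mathlib) for the contraction `P = E† U E` of `…ErgodicOperator`, `P [g] = [A g]` (`…ErgodicAverageLp`),
fixed points of `P` are invariant (`…ErgodicOperatorFix`, `…ErgodicCampbellSpace`), self-adjointness of the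
projection onto `Fix P`.

* `measurable_iterate_rerootAverage_and_bound` — iterates of `A` stay measurable and bounded;
* `meanErgodic_rerootAverage` — the theorem above (inside: `[A^[k] f] = P^[k] [f]`, the same for Cesàro
  averages, von Neumann, a measurable version of the limit, its invariant modification, and
  `⟪Π f, 1_I⟫ = ⟪f, 1_I⟫` by self-adjointness of the projection since `[1_I] ∈ Fix P`).

`[folklore]` (von Neumann 1932; Kallenberg FMP3 Thm 10.6/10.14 context).
-/

noncomputable section

namespace Summit.AtomisticToContinuum.Crystallization.Theorems.FrustratedLawDichotomyErgodicReduction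

open MeasureTheory Set Filter ProbabilityTheory Topology
open scoped ENNReal Classical InnerProductSpace
open Literature.Probability.Process (LocalConfig)
open Literature.Probability.Process.LocalConfig (RootedHardCoreConfig toMeasure_def measurable_toMeasure)
open Summit.AtomisticToContinuum.Crystallization.Theorems.BenjaminiSchrammLimit (isSFiniteKernel_toMeasure
  measurable_reroot)

variable {δ : ℝ}

/-- Iterates of the pointwise re-rooting average of a bounded measurable function are measurable and obey the
same bound. [folklore] -/
theorem measurable_iterate_rerootAverage_and_bound [Fact (0 < δ)] {w : EuclideanSpace ℝ (Fin 3) → ℝ≥0∞} (hw : Measurable w)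
    (hw1 : ∀ S : RootedHardCoreConfig (EuclideanSpace ℝ (Fin 3)) δ,
      ∫⁻ y, w y ∂((S.1 : LocalConfig (EuclideanSpace ℝ (Fin 3))).toMeasure) ≤ 1)
    {f : RootedHardCoreConfig (EuclideanSpace ℝ (Fin 3)) δ → ℝ} (hf : Measurable f) {C : ℝ} (hC : ∀ S, ‖f S‖ ≤ C) (k : ℕ) :
    Measurable ((fun (f : RootedHardCoreConfig (EuclideanSpace ℝ (Fin 3)) δ → ℝ) (S : RootedHardCoreConfig (EuclideanSpace ℝ (Fin 3)) δ) => ∫ y, f ((fun p : RootedHardCoreConfig (EuclideanSpace ℝ (Fin 3)) δ × EuclideanSpace ℝ (Fin 3) =>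
        ((if h : p.2 ∈ ((p.1.1 : LocalConfig (EuclideanSpace ℝ (Fin 3))) : Set (EuclideanSpace ℝ (Fin 3)))
          then p.1.reroot p.2 h else p.1 : RootedHardCoreConfig (EuclideanSpace ℝ (Fin 3)) δ), -p.2)) (S, y)).1 ∂((haveI := isSFiniteKernel_toMeasure (E := EuclideanSpace ℝ (Fin 3)) (δ := δ)
          Kernel.withDensity (⟨fun S : RootedHardCoreConfig (EuclideanSpace ℝ (Fin 3)) δ =>
        (S.1 : LocalConfig (EuclideanSpace ℝ (Fin 3))).toMeasure,
        measurable_toMeasure (Fact.out : 0 < δ)⟩ :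
        Kernel (RootedHardCoreConfig (EuclideanSpace ℝ (Fin 3)) δ) (EuclideanSpace ℝ (Fin 3)))
          (fun (S : RootedHardCoreConfig (EuclideanSpace ℝ (Fin 3)) δ) (y : EuclideanSpace ℝ (Fin 3)) =>
        w y + (1 - ∫⁻ z, w z ∂((S.1 : LocalConfig (EuclideanSpace ℝ (Fin 3))).toMeasure)) *
          ({(0 : EuclideanSpace ℝ (Fin 3))} : Set (EuclideanSpace ℝ (Fin 3))).indicator (fun _ => (1 : ℝ≥0∞)) y)) S))^[k] f) ∧ ∀ S, ‖((fun (f : RootedHardCoreConfig (EuclideanSpace ℝ (Fin 3)) δ → ℝ) (S : RootedHardCoreConfig (EuclideanSpace ℝ (Fin 3)) δ) => ∫ y, f ((fun p : RootedHardCoreConfig (EuclideanSpace ℝ (Fin 3)) δ × EuclideanSpace ℝ (Fin 3) =>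
        ((if h : p.2 ∈ ((p.1.1 : LocalConfig (EuclideanSpace ℝ (Fin 3))) : Set (EuclideanSpace ℝ (Fin 3)))
          then p.1.reroot p.2 h else p.1 : RootedHardCoreConfig (EuclideanSpace ℝ (Fin 3)) δ), -p.2)) (S, y)).1 ∂((haveI := isSFiniteKernel_toMeasure (E := EuclideanSpace ℝ (Fin 3)) (δ := δ)
          Kernel.withDensity (⟨fun S : RootedHardCoreConfig (EuclideanSpace ℝ (Fin 3)) δ =>
        (S.1 : LocalConfig (EuclideanSpace ℝ (Fin 3))).toMeasure,
        measurable_toMeasure (Fact.out : 0 < δ)⟩ :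
        Kernel (RootedHardCoreConfig (EuclideanSpace ℝ (Fin 3)) δ) (EuclideanSpace ℝ (Fin 3)))
          (fun (S : RootedHardCoreConfig (EuclideanSpace ℝ (Fin 3)) δ) (y : EuclideanSpace ℝ (Fin 3)) =>
        w y + (1 - ∫⁻ z, w z ∂((S.1 : LocalConfig (EuclideanSpace ℝ (Fin 3))).toMeasure)) *
          ({(0 : EuclideanSpace ℝ (Fin 3))} : Set (EuclideanSpace ℝ (Fin 3))).indicator (fun _ => (1 : ℝ≥0∞)) y)) S))^[k] f) S‖ ≤ C := by
  induction k with
  | zero => exact ⟨hf, hC⟩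
  | succ k ih =>
    rw [Function.iterate_succ_apply']
    exact ⟨(stronglyMeasurable_rerootAverage hw hw1 ih.1).measurable, norm_rerootAverage_le hw hw1 ih.2⟩

/-- **Mean ergodic theorem for the pointwise re-rooting averages** (`δ > 0`).  Let `ν` be a probability law on
rooted `δ`-hard-core configurations of `ℝ³` whose Campbell measure is invariant under the re-rooting involution,
`w` a measurable, even, everywhere positive weight of mass `≤ 1` on every configuration, and `f` a bounded
measurable real function.  Then there is a measurable, EXACTLY re-rooting-invariant, bounded `f̄` such that
(i) `∫_I f̄ dν = ∫_I f dν` for every measurable re-rooting-invariant `I`, and (ii) the Cesàro averages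
`n⁻¹ Σ_{k<n} A^k f` of the pointwise re-rooting operator converge to `f̄` in `L²(ν)`
(`eLpNorm (… − f̄) 2 ν → 0`). [folklore] -/
theorem meanErgodic_rerootAverage [Fact (0 < δ)]
    {ν : Measure (RootedHardCoreConfig (EuclideanSpace ℝ (Fin 3)) δ)} [IsProbabilityMeasure ν]
    (hinv : haveI := isSFiniteKernel_toMeasure (E := EuclideanSpace ℝ (Fin 3)) (δ := δ)
      (ν ⊗ₘ (⟨fun S : RootedHardCoreConfig (EuclideanSpace ℝ (Fin 3)) δ =>
        (S.1 : LocalConfig (EuclideanSpace ℝ (Fin 3))).toMeasure,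
        measurable_toMeasure (Fact.out : 0 < δ)⟩ :
        Kernel (RootedHardCoreConfig (EuclideanSpace ℝ (Fin 3)) δ) (EuclideanSpace ℝ (Fin 3)))).map
      (fun p : RootedHardCoreConfig (EuclideanSpace ℝ (Fin 3)) δ × EuclideanSpace ℝ (Fin 3) =>
        ((if h : p.2 ∈ ((p.1.1 : LocalConfig (EuclideanSpace ℝ (Fin 3))) : Set (EuclideanSpace ℝ (Fin 3)))
          then p.1.reroot p.2 h else p.1 : RootedHardCoreConfig (EuclideanSpace ℝ (Fin 3)) δ), -p.2)) =
      ν ⊗ₘ (⟨fun S : RootedHardCoreConfig (EuclideanSpace ℝ (Fin 3)) δ =>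
        (S.1 : LocalConfig (EuclideanSpace ℝ (Fin 3))).toMeasure,
        measurable_toMeasure (Fact.out : 0 < δ)⟩ :
        Kernel (RootedHardCoreConfig (EuclideanSpace ℝ (Fin 3)) δ) (EuclideanSpace ℝ (Fin 3))))
    {w : EuclideanSpace ℝ (Fin 3) → ℝ≥0∞} (hw : Measurable w) (hws : ∀ y, w (-y) = w y) (hw0 : ∀ y, w y ≠ 0)
    (hw1 : ∀ S : RootedHardCoreConfig (EuclideanSpace ℝ (Fin 3)) δ,
      ∫⁻ y, w y ∂((S.1 : LocalConfig (EuclideanSpace ℝ (Fin 3))).toMeasure) ≤ 1)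
    {f : RootedHardCoreConfig (EuclideanSpace ℝ (Fin 3)) δ → ℝ} (hf : Measurable f) {C : ℝ} (hC : ∀ S, ‖f S‖ ≤ C) :
    ∃ fbar : RootedHardCoreConfig (EuclideanSpace ℝ (Fin 3)) δ → ℝ, Measurable fbar ∧
      (∀ (S : RootedHardCoreConfig (EuclideanSpace ℝ (Fin 3)) δ) (y : EuclideanSpace ℝ (Fin 3))
        (hy : y ∈ ((S.1 : LocalConfig (EuclideanSpace ℝ (Fin 3))) : Set (EuclideanSpace ℝ (Fin 3)))), fbar (S.reroot y hy) = fbar S) ∧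
      MemLp fbar 2 ν ∧
      (∀ I : Set (RootedHardCoreConfig (EuclideanSpace ℝ (Fin 3)) δ), MeasurableSet I →
        (∀ (S : RootedHardCoreConfig (EuclideanSpace ℝ (Fin 3)) δ) (y : EuclideanSpace ℝ (Fin 3))
          (hy : y ∈ ((S.1 : LocalConfig (EuclideanSpace ℝ (Fin 3))) : Set (EuclideanSpace ℝ (Fin 3)))), S ∈ I ↔ S.reroot y hy ∈ I) →
        ∫ S in I, fbar S ∂ν = ∫ S in I, f S ∂ν) ∧
      Tendsto (fun n : ℕ => eLpNorm (birkhoffAverage ℝ (fun (f : RootedHardCoreConfig (EuclideanSpace ℝ (Fin 3)) δ → ℝ) (S : RootedHardCoreConfig (EuclideanSpace ℝ (Fin 3)) δ) => ∫ y, f ((fun p : RootedHardCoreConfig (EuclideanSpace ℝ (Fin 3)) δ × EuclideanSpace ℝ (Fin 3) =>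
        ((if h : p.2 ∈ ((p.1.1 : LocalConfig (EuclideanSpace ℝ (Fin 3))) : Set (EuclideanSpace ℝ (Fin 3)))
          then p.1.reroot p.2 h else p.1 : RootedHardCoreConfig (EuclideanSpace ℝ (Fin 3)) δ), -p.2)) (S, y)).1 ∂((haveI := isSFiniteKernel_toMeasure (E := EuclideanSpace ℝ (Fin 3)) (δ := δ)
          Kernel.withDensity (⟨fun S : RootedHardCoreConfig (EuclideanSpace ℝ (Fin 3)) δ =>
        (S.1 : LocalConfig (EuclideanSpace ℝ (Fin 3))).toMeasure,
        measurable_toMeasure (Fact.out : 0 < δ)⟩ :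
        Kernel (RootedHardCoreConfig (EuclideanSpace ℝ (Fin 3)) δ) (EuclideanSpace ℝ (Fin 3)))
          (fun (S : RootedHardCoreConfig (EuclideanSpace ℝ (Fin 3)) δ) (y : EuclideanSpace ℝ (Fin 3)) =>
        w y + (1 - ∫⁻ z, w z ∂((S.1 : LocalConfig (EuclideanSpace ℝ (Fin 3))).toMeasure)) *
          ({(0 : EuclideanSpace ℝ (Fin 3))} : Set (EuclideanSpace ℝ (Fin 3))).indicator (fun _ => (1 : ℝ≥0∞)) y)) S)) _root_.id n f - fbar) 2 ν) atTop (𝓝 0) := by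
  haveI := isSFiniteKernel_toMeasure (E := EuclideanSpace ℝ (Fin 3)) (δ := δ)
  have hδ : 0 < δ := Fact.out
  have hΘ : Measurable (fun p : RootedHardCoreConfig (EuclideanSpace ℝ (Fin 3)) δ × EuclideanSpace ℝ (Fin 3) =>
        ((if h : p.2 ∈ ((p.1.1 : LocalConfig (EuclideanSpace ℝ (Fin 3))) : Set (EuclideanSpace ℝ (Fin 3)))
          then p.1.reroot p.2 h else p.1 : RootedHardCoreConfig (EuclideanSpace ℝ (Fin 3)) δ), -p.2)) := measurable_reroot hδ
  obtain ⟨P, hP1, hfix, hP⟩ := exists_rerootOperator_toLp (δ := δ) hinv hw hws hw1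
  -- abbreviations
  set A : (RootedHardCoreConfig (EuclideanSpace ℝ (Fin 3)) δ → ℝ) → (RootedHardCoreConfig (EuclideanSpace ℝ (Fin 3)) δ → ℝ) := (fun (f : RootedHardCoreConfig (EuclideanSpace ℝ (Fin 3)) δ → ℝ) (S : RootedHardCoreConfig (EuclideanSpace ℝ (Fin 3)) δ) => ∫ y, f ((fun p : RootedHardCoreConfig (EuclideanSpace ℝ (Fin 3)) δ × EuclideanSpace ℝ (Fin 3) =>
        ((if h : p.2 ∈ ((p.1.1 : LocalConfig (EuclideanSpace ℝ (Fin 3))) : Set (EuclideanSpace ℝ (Fin 3)))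
          then p.1.reroot p.2 h else p.1 : RootedHardCoreConfig (EuclideanSpace ℝ (Fin 3)) δ), -p.2)) (S, y)).1 ∂((haveI := isSFiniteKernel_toMeasure (E := EuclideanSpace ℝ (Fin 3)) (δ := δ)
          Kernel.withDensity (⟨fun S : RootedHardCoreConfig (EuclideanSpace ℝ (Fin 3)) δ =>
        (S.1 : LocalConfig (EuclideanSpace ℝ (Fin 3))).toMeasure,
        measurable_toMeasure (Fact.out : 0 < δ)⟩ :
        Kernel (RootedHardCoreConfig (EuclideanSpace ℝ (Fin 3)) δ) (EuclideanSpace ℝ (Fin 3)))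
          (fun (S : RootedHardCoreConfig (EuclideanSpace ℝ (Fin 3)) δ) (y : EuclideanSpace ℝ (Fin 3)) =>
        w y + (1 - ∫⁻ z, w z ∂((S.1 : LocalConfig (EuclideanSpace ℝ (Fin 3))).toMeasure)) *
          ({(0 : EuclideanSpace ℝ (Fin 3))} : Set (EuclideanSpace ℝ (Fin 3))).indicator (fun _ => (1 : ℝ≥0∞)) y)) S)) with hA_def
  have hit := fun k => measurable_iterate_rerootAverage_and_bound (δ := δ) hw hw1 hf hC k
  have hmem : ∀ k, MemLp (A^[k] f) 2 ν := fun k =>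
    MemLp.of_bound (hit k).1.aestronglyMeasurable C (Eventually.of_forall (hit k).2)
  have hf2 : MemLp f 2 ν := hmem 0
  -- `[A^[k] f] = P^[k] [f]`
  have hiter : ∀ k, (hmem k).toLp (A^[k] f) = (⇑P)^[k] (hf2.toLp f) := by
    intro k
    induction k with
    | zero => rfl
    | succ k ih =>
      conv_rhs => rw [Function.iterate_succ_apply', ← ih]
      rw [hP (A^[k] f) (hit k).1 C (hit k).2 (hmem k)]
      exact MemLp.toLp_congr _ _ (Eventually.of_forall fun S => by rw [Function.iterate_succ_apply'])
  -- Cesàro averages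
  have hba_eq : ∀ n : ℕ, birkhoffAverage ℝ A _root_.id n f = (n : ℝ)⁻¹ • ∑ k ∈ Finset.range n, A^[k] f :=
    fun n => by simp only [birkhoffAverage, birkhoffSum, _root_.id]
  have hbaP_eq : ∀ (n : ℕ) (x : Lp ℝ 2 ν),
      birkhoffAverage ℝ (⇑P) _root_.id n x = (n : ℝ)⁻¹ • ∑ k ∈ Finset.range n, (⇑P)^[k] x :=
    fun n x => by simp only [birkhoffAverage, birkhoffSum, _root_.id]
  have hsum : ∀ m : ℕ, (memLp_finsetSum' (Finset.range m) fun k _ => hmem k).toLp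
      (∑ k ∈ Finset.range m, A^[k] f) = ∑ k ∈ Finset.range m, (⇑P)^[k] (hf2.toLp f) := by
    intro m
    induction m with
    | zero =>
      have h0 : (memLp_finsetSum' (Finset.range 0) fun k _ => hmem k).toLp
          (∑ k ∈ Finset.range 0, A^[k] f) = (MemLp.zero' : MemLp (0 : RootedHardCoreConfig (EuclideanSpace ℝ (Fin 3)) δ → ℝ) 2 ν).toLp 0 :=
        MemLp.toLp_congr _ _ (Eventually.of_forall fun S => by simp only [Finset.sum_range_zero])
      rw [h0, MeasureTheory.MemLp.toLp_zero, Finset.sum_range_zero]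
    | succ m ihm =>
      calc (memLp_finsetSum' (Finset.range (m + 1)) fun k _ => hmem k).toLp
            (∑ k ∈ Finset.range (m + 1), A^[k] f)
          = ((memLp_finsetSum' (Finset.range m) fun k _ => hmem k).add (hmem m)).toLp
              ((∑ k ∈ Finset.range m, A^[k] f) + A^[m] f) :=
            MemLp.toLp_congr _ _ (Eventually.of_forall fun S => by
              simp only [Finset.sum_range_succ])
        _ = (memLp_finsetSum' (Finset.range m) fun k _ => hmem k).toLp (∑ k ∈ Finset.range m, A^[k] f) +
              (hmem m).toLp (A^[m] f) := MemLp.toLp_add _ _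
        _ = ∑ k ∈ Finset.range m, (⇑P)^[k] (hf2.toLp f) + (⇑P)^[m] (hf2.toLp f) := by rw [ihm, hiter m]
        _ = ∑ k ∈ Finset.range (m + 1), (⇑P)^[k] (hf2.toLp f) := (Finset.sum_range_succ _ _).symm
  have hces_mem : ∀ n : ℕ, MemLp (birkhoffAverage ℝ A _root_.id n f) 2 ν := fun n => by
    rw [hba_eq]
    exact (memLp_finsetSum' (Finset.range n) fun k _ => hmem k).const_smul _
  have hces : ∀ n : ℕ, (hces_mem n).toLp (birkhoffAverage ℝ A _root_.id n f) =
      birkhoffAverage ℝ (⇑P) _root_.id n (hf2.toLp f) := by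
    intro n
    calc (hces_mem n).toLp (birkhoffAverage ℝ A _root_.id n f)
        = ((memLp_finsetSum' (Finset.range n) fun k _ => hmem k).const_smul ((n : ℝ)⁻¹)).toLp
            ((n : ℝ)⁻¹ • ∑ k ∈ Finset.range n, A^[k] f) :=
          MemLp.toLp_congr _ _ (Eventually.of_forall fun S => by rw [hba_eq])
      _ = (n : ℝ)⁻¹ • (memLp_finsetSum' (Finset.range n) fun k _ => hmem k).toLp
            (∑ k ∈ Finset.range n, A^[k] f) := MemLp.toLp_const_smul _ _
      _ = (n : ℝ)⁻¹ • ∑ k ∈ Finset.range n, (⇑P)^[k] (hf2.toLp f) := by rw [hsum n]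
      _ = birkhoffAverage ℝ (⇑P) _root_.id n (hf2.toLp f) := by rw [hbaP_eq]
  -- von Neumann
  have hvN := P.tendsto_birkhoffAverage_orthogonalProjection hP1 (hf2.toLp f)
  set y : Lp ℝ 2 ν := (((P.eqLocus (1 : Lp ℝ 2 ν →L[ℝ] Lp ℝ 2 ν)).orthogonalProjectionOnto (hf2.toLp f) :
      (P.eqLocus (1 : Lp ℝ 2 ν →L[ℝ] Lp ℝ 2 ν))) : Lp ℝ 2 ν) with hy_def
  have hy_mem : y ∈ P.eqLocus (1 : Lp ℝ 2 ν →L[ℝ] Lp ℝ 2 ν) := Submodule.coe_mem _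
  have hPy : P y = y := LinearMap.mem_eqLocus.1 hy_mem
  -- a measurable version of the limit and its invariant modification
  have hy_ae := (Lp.aestronglyMeasurable y)
  set h : RootedHardCoreConfig (EuclideanSpace ℝ (Fin 3)) δ → ℝ := hy_ae.mk _ with hh_def
  have hh_meas : Measurable h := hy_ae.stronglyMeasurable_mk.measurable
  have hh_ae : (y : RootedHardCoreConfig (EuclideanSpace ℝ (Fin 3)) δ → ℝ) =ᵐ[ν] h := hy_ae.ae_eq_mk
  have hh2 : MemLp h 2 ν := (Lp.memLp y).ae_eq hh_ae
  have hy_eq : hh2.toLp h = y := by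
    rw [← Lp.toLp_coeFn y (Lp.memLp y)]
    exact MemLp.toLp_congr _ _ hh_ae.symm
  have hPh : P (hh2.toLp h) = hh2.toLp h := by rw [hy_eq, hPy]
  have hedge := hfix h hh2 hPh
  obtain ⟨fbar, hfbar_meas, hfbar_ae, hfbar_inv⟩ :=
    exists_invariant_ae_eq_of_campbell (δ := δ) hinv hw hw0 hh_meas hedge
  have hfbar2 : MemLp fbar 2 ν := hh2.ae_eq hfbar_ae.symm
  have hfbar_y : hfbar2.toLp fbar = y := by
    rw [← hy_eq]; exact MemLp.toLp_congr _ _ hfbar_ae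
  refine ⟨fbar, hfbar_meas, hfbar_inv, hfbar2, ?_, ?_⟩
  · -- `∫_I fbar = ∫_I f` for invariant measurable `I`
    intro I hI hIinv
    have hind_meas : Measurable (I.indicator (fun _ => (1 : ℝ))) := measurable_const.indicator hI
    have hind_bd : ∀ S, ‖I.indicator (fun _ => (1 : ℝ)) S‖ ≤ 1 := fun S => by
      by_cases hS : S ∈ I <;> simp [hS]
    have hind2 : MemLp (I.indicator (fun _ => (1 : ℝ))) 2 ν :=
      MemLp.of_bound hind_meas.aestronglyMeasurable 1 (Eventually.of_forall hind_bd)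
    -- `[1_I]` is a fixed point of `P`
    have hfixI : P (hind2.toLp _) = hind2.toLp _ := by
      rw [hP _ hind_meas 1 hind_bd hind2]
      refine MemLp.toLp_congr _ _ (Eventually.of_forall fun S => ?_)
      exact rerootAverage_eq_self_of_invariant hw hw1 (fun S y hy => by
        simp only [Set.indicator_apply, hIinv S y hy]) S
    have hI_mem : hind2.toLp _ ∈ P.eqLocus (1 : Lp ℝ 2 ν →L[ℝ] Lp ℝ 2 ν) :=
      LinearMap.mem_eqLocus.2 (by simpa using hfixI)
    -- self-adjointness of the projection
    have hinner : ⟪y, hind2.toLp _⟫_ℝ = ⟪hf2.toLp f, hind2.toLp _⟫_ℝ := by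
      rw [hy_def, ← Submodule.starProjection_apply, Submodule.inner_starProjection_left_eq_right,
        Submodule.starProjection_eq_self_iff.2 hI_mem]
    rw [← hfbar_y, MeasureTheory.L2.inner_def, MeasureTheory.L2.inner_def] at hinner
    have h1 : ∫ S, ⟪(hfbar2.toLp fbar) S, (hind2.toLp (I.indicator fun _ => (1 : ℝ))) S⟫_ℝ ∂ν =
        ∫ S in I, fbar S ∂ν := by
      rw [← integral_indicator hI]
      refine integral_congr_ae ?_
      filter_upwards [hfbar2.coeFn_toLp, hind2.coeFn_toLp] with S hS1 hS2
      rw [hS1, hS2]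
      by_cases hS : S ∈ I <;> simp [hS]
    have h2 : ∫ S, ⟪(hf2.toLp f) S, (hind2.toLp (I.indicator fun _ => (1 : ℝ))) S⟫_ℝ ∂ν =
        ∫ S in I, f S ∂ν := by
      rw [← integral_indicator hI]
      refine integral_congr_ae ?_
      filter_upwards [hf2.coeFn_toLp, hind2.coeFn_toLp] with S hS1 hS2
      rw [hS1, hS2]
      by_cases hS : S ∈ I <;> simp [hS]
    rw [h1, h2] at hinner
    exact hinner
  · -- `L²` convergence of the Cesàro averages
    rw [← Lp.tendsto_Lp_iff_tendsto_eLpNorm'' _ hces_mem fbar hfbar2, hfbar_y]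
    simp_rw [hces]
    exact hvN

end Summit.AtomisticToContinuum.Crystallization.Theorems.FrustratedLawDichotomyErgodicReduction

end
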